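import Mathlib
import HarnessLib
import Summits.HubbardSuperconductivity.HubbardSuperconductivity.Theorems.KLProgrammeKLRegimeCountertermJacksonRemainderOneCallGraded
import Summits.HubbardSuperconductivity.HubbardSuperconductivity.Theorems.KLProgrammeKLRegimeCountertermJacksonRemainderGlobalSizesGraded

/-!
# (C1) JACKSON REMAINDER AT DEEP SCALES — the ONE-CALL door with GRADED curve jets AND STRUCTURED global sizes

Cell `gate-hubbard-kl`, seat hubbard-kl-k3c3-p3 (g11), `--supports stmt-HubbardSuperconductivity-20437` (stub (C) of `KLRegimeEngineV17F2`); pen (R79)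
«(C1)-DEEP analytic supplier».  Memo `HOME/hubbard-kl-k3c3-p3/C1-JETBOX-DEEP.md` §6(i).

`flowPiece_reading_remainder_jets_oneCall_bell` (…OneCallGraded) still discharges the far rows' global sizes with k3c3-p1's single-constant
`(i!)²(2·i!·X·200ⁱ)·G·(…)ⁱ` — the located «FAR-ROWS-STRUCTURED» obstruction (`B₄ ≈ 6·10²³·G`).  This file swaps in the GRADED global sizes of
…GlobalSizesGraded (`norm_iteratedFDeriv_onM_klFrameExtFn_meanFree_le_graded`: `B i = Σ_j C(i,j)·X_j·Ang_{i−j}`, `X = (1, 640/3, 1205120/9,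
23040401280, 1512668168424320/9)`, `Ang = (G₀, a₁/r, (a₂+a₁)/r², (a₃+3a₂+2a₁)/r³, (a₄+6a₃+11a₂+6a₁)/r⁴)`, `r = 8/5`) while keeping k3c3-p1's LOCAL
sizes `Ml = (G₀ | a₁/ρ | (a₂+a₁)/ρ² | (a₃+3a₂+2a₁)/ρ³ | (a₄+6a₃+11a₂+6a₁)/ρ⁴)`:

**`flowPiece_reading_remainder_jets_oneCall_structured`** — inputs: the reading's angular data `a k` (`1 ≤ k ≤ 4`), `G₀ ≥ |f − mean f|`, the centre
numbers, graded curve jets `D i`, margin `δ`, first moment `m₁`; output: the value and four jets of `R = (klFlowPiece n).eval∘k_F^{K′} − ν_n(K_n)` in ROW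
form (`m₁`-rows, `τ`-rows, top row) with every size LINEAR in `(G₀, a₁, …, a₄)` — so that at reading scale `n+1` each row is a row of
`jacksonScale_term_law` / `jacksonScale_frame_term_law` (…JacksonRemainderScaleLaw).  No `χ₂` numeral input is needed any more.

Bookkeeping only; no definitions; nothing about the model.
-/

noncomputable section

namespace Summit.HubbardSuperconductivity.HubbardSuperconductivity.Theorems.KLRegimeSplit

set_option linter.dupNamespace false -- summit = problem name (single-conjunct summit), D-0017

open Real MeasureTheory Filter Finset
open Literature.Analysis.Fourier.TrigApprox Literature.MathematicalPhysics.QuantumLattice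
open Summit.HubbardSuperconductivity.HubbardSuperconductivity.Theorems.PerturbedFermiCurve

section Structured

variable {L M : ℕ} [NeZero L] [NeZero M]

/-- **THE (C1) DOOR, ONE CALL, GRADED CURVE JETS, STRUCTURED GLOBAL SIZES, ROW FORM.**  `f := ν_n(K_n)` (`C⁴`), `K′` any frame whose Fermi
points the extension reads (`hon`); angular data `‖Dᵏf‖ ≤ a k` (`1 ≤ k ≤ 4`), `|f − mean f| ≤ G₀`; centre numbers `|ε(x) − μ| + 4r < klFlatR`,
`|xᵢ| + r < π`, `ρ + r ≤ ‖x‖` at `x = k_F^{K′}(θ)`; margin `0 < δ ≤ π`, `2δ ≤ r`; first moment `m₁`; GRADED curve jets `‖γ^{(i)}(θ)‖ ≤ D i`.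
With `τ = π³/((d+1)δ)³`, `d = klFlowDeg n`, LOCAL sizes `Ml` (as in part 6) and STRUCTURED GLOBAL sizes
`B 0 = G₀`, `B 1 = a₁/r + X₁G₀`, `B 2 = A₂ + 2X₁A₁ + X₂G₀`, `B 3 = A₃ + 3X₁A₂ + 3X₂A₁ + X₃G₀`, `B 4 = A₄ + 4X₁A₃ + 6X₂A₂ + 4X₃A₁ + X₄G₀`
(`A₁ = a₁/r`, `A₂ = (a₂+a₁)/r²`, `A₃ = (a₃+3a₂+2a₁)/r³`, `A₄ = (a₄+6a₃+11a₂+6a₁)/r⁴`, `r = 8/5`, `X = (640/3, 1205120/9, 23040401280, 1512668168424320/9)`),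
the five rows of `flowPiece_reading_remainder_jets_meanFree_bell` hold. -/
theorem flowPiece_reading_remainder_jets_oneCall_structured (β U : ℝ) {μ : ℝ} (hμ : μ ∈ klWindowC) (n : ℕ) (K' : TrigPolyC4v)
    (hf : ContDiff ℝ 4 fun θ : ℝ => klLocalPart L M β U μ (klFlowFrameU L M β U μ n) n θ)
    (hon : ∀ θ, klFrameExtFn μ (fun θ => klLocalPart L M β U μ (klFlowFrameU L M β U μ n) n θ) (klFermiPoint μ K' θ) =
      klLocalPart L M β U μ (klFlowFrameU L M β U μ n) n θ)
    (hγ : ContDiff ℝ 4 fun θ => (WithLp.toLp 2 (klFermiPoint μ K' θ) : EuclideanSpace ℝ (Fin 2)))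
    {θ r ρ δ G₀ m₁ : ℝ} {a D : ℕ → ℝ}
    (ha : ∀ k, 1 ≤ k → k ≤ 4 → ∀ t : ℝ,
      ‖iteratedFDeriv ℝ k (fun θ : ℝ => klLocalPart L M β U μ (klFlowFrameU L M β U μ n) n θ) t‖ ≤ a k)
    (hG₀ : ∀ t : ℝ, |klLocalPart L M β U μ (klFlowFrameU L M β U μ n) n t -
      klAngularMean (fun θ : ℝ => klLocalPart L M β U μ (klFlowFrameU L M β U μ n) n θ)| ≤ G₀)
    (hρ : 0 < ρ)
    (htube : |sqDispersion (WithLp.ofLp (WithLp.toLp 2 (klFermiPoint μ K' θ) : EuclideanSpace ℝ (Fin 2))) - μ| + 4 * r < klFlatR)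
    (hcell : ∀ i, |WithLp.ofLp (WithLp.toLp 2 (klFermiPoint μ K' θ) : EuclideanSpace ℝ (Fin 2)) i| + r < π)
    (hrad : ρ + r ≤ ‖(WithLp.toLp 2 (klFermiPoint μ K' θ) : EuclideanSpace ℝ (Fin 2))‖)
    (hδ : 0 < δ) (hδπ : δ ≤ π) (hδr : 2 * δ ≤ r) (hm₁ : ∫ w, jweight (klFlowDeg n) w * (|w.1| + |w.2|) ∂jmeas ≤ m₁)
    (hD : ∀ i, 1 ≤ i → i ≤ 4 →
      ‖iteratedDeriv i (fun θ => (WithLp.toLp 2 (klFermiPoint μ K' θ) : EuclideanSpace ℝ (Fin 2))) θ‖ ≤ D i) :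
    let Ml : ℕ → ℝ := fun i => match i with
      | 0 => G₀
      | 1 => a 1 / ρ
      | 2 => (a 2 + a 1) / ρ ^ 2
      | 3 => (a 3 + 3 * a 2 + 2 * a 1) / ρ ^ 3
      | _ => (a 4 + 6 * a 3 + 11 * a 2 + 6 * a 1) / ρ ^ 4
    let A₁ : ℝ := a 1 / (8 / 5)
    let A₂ : ℝ := (a 2 + a 1) / (8 / 5) ^ 2
    let A₃ : ℝ := (a 3 + 3 * a 2 + 2 * a 1) / (8 / 5) ^ 3
    let A₄ : ℝ := (a 4 + 6 * a 3 + 11 * a 2 + 6 * a 1) / (8 / 5) ^ 4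
    let B : ℕ → ℝ := fun i => match i with
      | 0 => G₀
      | 1 => A₁ + 640 / 3 * G₀
      | 2 => A₂ + 2 * (640 / 3) * A₁ + 1205120 / 9 * G₀
      | 3 => A₃ + 3 * (640 / 3) * A₂ + 3 * (1205120 / 9) * A₁ + 23040401280 * G₀
      | _ => A₄ + 4 * (640 / 3) * A₃ + 6 * (1205120 / 9) * A₂ + 4 * 23040401280 * A₁ + 1512668168424320 / 9 * G₀
    let τ : ℝ := π ^ 3 / ((klFlowDeg n + 1) * δ) ^ 3
    |(klFlowPiece L M β U μ n).eval (klFermiPoint μ K' θ) - klLocalPart L M β U μ (klFlowFrameU L M β U μ n) n θ| ≤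
      m₁ * Ml 1 + τ * (B 0 + Ml 0) ∧
    |iteratedDeriv 1 (fun θ => (klFlowPiece L M β U μ n).eval (klFermiPoint μ K' θ) -
        klLocalPart L M β U μ (klFlowFrameU L M β U μ n) n θ) θ| ≤ m₁ * (Ml 2 * D 1) + τ * ((B 1 + Ml 1) * D 1) ∧
    |iteratedDeriv 2 (fun θ => (klFlowPiece L M β U μ n).eval (klFermiPoint μ K' θ) -
        klLocalPart L M β U μ (klFlowFrameU L M β U μ n) n θ) θ| ≤
      m₁ * (Ml 3 * D 1 ^ 2 + Ml 2 * D 2) + τ * ((B 2 + Ml 2) * D 1 ^ 2 + (B 1 + Ml 1) * D 2) ∧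
    |iteratedDeriv 3 (fun θ => (klFlowPiece L M β U μ n).eval (klFermiPoint μ K' θ) -
        klLocalPart L M β U μ (klFlowFrameU L M β U μ n) n θ) θ| ≤
      m₁ * (Ml 4 * D 1 ^ 3 + 3 * Ml 3 * D 1 * D 2 + Ml 2 * D 3) +
        τ * ((B 3 + Ml 3) * D 1 ^ 3 + 3 * (B 2 + Ml 2) * D 1 * D 2 + (B 1 + Ml 1) * D 3) ∧
    |iteratedDeriv 4 (fun θ => (klFlowPiece L M β U μ n).eval (klFermiPoint μ K' θ) -
        klLocalPart L M β U μ (klFlowFrameU L M β U μ n) n θ) θ| ≤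
      2 * Ml 4 * D 1 ^ 4 +
        m₁ * (6 * Ml 4 * D 1 ^ 2 * D 2 + 3 * Ml 3 * D 2 ^ 2 + 4 * Ml 3 * D 1 * D 3 + Ml 2 * D 4) +
        τ * (B 4 * D 1 ^ 4 + 6 * (B 3 + Ml 3) * D 1 ^ 2 * D 2 + 3 * (B 2 + Ml 2) * D 2 ^ 2 + 4 * (B 2 + Ml 2) * D 1 * D 3 +
          (B 1 + Ml 1) * D 4) := by
  intro Ml A₁ A₂ A₃ A₄ B τ
  set f : ℝ → ℝ := fun θ => klLocalPart L M β U μ (klFlowFrameU L M β U μ n) n θ with hfdef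
  have hper : Function.Periodic f (2 * Real.pi) := klLocalPart_periodic β U μ _ n
  have hfi : IntervalIntegrable f volume 0 (2 * π) := hf.continuous.intervalIntegrable _ _
  have hg : ContDiff ℝ 4 (fun t : ℝ => f t - klAngularMean f) := hf.sub contDiff_const
  have hgper : Function.Periodic (fun t : ℝ => f t - klAngularMean f) (2 * Real.pi) := fun t => by
    show f (t + 2 * Real.pi) - klAngularMean f = f t - klAngularMean f
    rw [hper t]
  -- STRUCTURED global sizes of the mean-free extension
  have hB : ∀ i ≤ 4, ∀ y, ‖iteratedFDeriv ℝ i (onM (klFrameExtFn μ fun t => f t - klAngularMean f)) y‖ ≤ B i := by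
    intro i hi y
    have h := norm_iteratedFDeriv_onM_klFrameExtFn_meanFree_le_graded hf hper hμ (b := fun k => if k = 0 then G₀ else a k)
      (by simpa using hG₀) (fun k hk1 hk4 t => by simpa [show k ≠ 0 by omega] using ha k hk1 hk4 t) hi y
    refine h.trans (le_of_eq ?_)
    interval_cases i <;> simp [B, A₁, A₂, A₃, A₄, sum_range_succ, Nat.choose]
  -- local sizes on the ball, at the mean-free profile
  have ha' : ∀ k, 1 ≤ k → k ≤ 4 → ∀ t : ℝ, ‖iteratedFDeriv ℝ k (fun t => f t - klAngularMean f) t‖ ≤ a k := by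
    intro k hk1 hk4 t
    rw [norm_iteratedFDeriv_sub_const_of_one_le f _ hk1]
    exact ha k hk1 hk4 t
  have hG₀' : ∀ t : ℝ, |(f t - klAngularMean f) - klAngularMean (fun t => f t - klAngularMean f)| ≤ G₀ := by
    intro t
    rw [klAngularMean_sub_mean f hfi, sub_zero]
    exact hG₀ t
  have hMl : ∀ i ≤ 4, ∀ y : EuclideanSpace ℝ (Fin 2), ‖y - WithLp.toLp 2 (klFermiPoint μ K' θ)‖ ≤ r →
      ‖iteratedFDeriv ℝ i (onM (klFrameExtFn μ fun t => f t - klAngularMean f)) y‖ ≤ Ml i := by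
    intro i hi y hy
    have h := localSizes_onM_klFrameExtFn_of_ball hg hgper hρ htube hcell hrad ha' hG₀' hi y hy
    rw [klAngularMean_sub_mean f hfi, abs_zero, zero_add] at h
    interval_cases i <;> exact h
  exact flowPiece_reading_remainder_jets_meanFree_bell (L := L) (M := M) β U hμ n K' hf hon hB hγ hMl hδ hδπ hδr hm₁ hD

end Structured

end Summit.HubbardSuperconductivity.HubbardSuperconductivity.Theorems.KLRegimeSplit

end
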